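import Mathlib
import Summits.KontsevichZagierPeriods.Zeta5Search.SecondOrderAggregate
import HarnessLib

/-!
# ζ(5) search — THEOREM A‴, assembly of the aggregates: `W/(−p)^{m+3} ≡ −pX`, `V/(−p)^m ≡ −pY (mod p²)` with `(X, Y) ≡ α τ(T)`

Cell `pub-zeta5` (HONEST FRAMING: systematic search; no irrationality claim unless certified), typer seat generation 11.
REPORT-gen2-g10 §3, proof of THEOREM A‴, the step "`Ω̃ = pΩ̃′`, `Ñ = pÑ′` with `(Ω̃′, Ñ′) ≡ (X, Y)`, all of them multiples of one
vector": under the class hypotheses of `SecondOrder.LawA3` for ONE parameter vector `b` there are `p`-integral `X, Y` and a scalar `α`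
with `‖W(b)/(−p)^{3−M} + pX‖ ≤ p⁻²`, `‖V(b)/(−p)^{−M} + pY‖ ≤ p⁻²`, `‖X − ατ_W(T)‖ ≤ p⁻¹`, `‖Y − ατ_V(T)‖ ≤ p⁻¹` (`aggregate`),
where `X = Σ_{deep} ĝφŵ₂ + Σ_{sub-deep} ĝŵ`, `Y = Σ_{deep} ĝφ(v̂₂ − (L/2)v̂) + Σ_{sub-deep} ĝv̂`, `α = ½(Σ_{deep} ĝφ + Σ c_y)` and
`τ(T)` depends on the list `T` only.  Inputs: `deepW/V_norm`, `subW/V_norm`, `restW/V_norm`, `deep_data`, `gHat_pair_second`,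
`sub_pair_norm`, and the conjugation involution (`sum_conj_symm`).  Nothing here bears on irrationality.
-/

noncomputable section

open Finset PowerSeries

namespace Summit.KontsevichZagierPeriods.Zeta5Search.SecondOrder

open Summit.KontsevichZagierPeriods.Zeta5Search.DualSeries (InBox)
open Summit.KontsevichZagierPeriods.Zeta5Search.WedgeDictionary (coeffW coeffV)
open Summit.KontsevichZagierPeriods.Zeta5Search.CasoratianValuation (InPolytope)
open Summit.KontsevichZagierPeriods.Zeta5Search.ClusterValuation
open Summit.KontsevichZagierPeriods.Zeta5Search.PadicSeries
open Summit.KontsevichZagierPeriods.Zeta5Search.CellA (classW coeffW_eq_sum_classW padicNorm_p padicNorm_classRho_le_one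
  padicNorm_harm_le_one padicNorm_pow_eq)
open Literature.NumberTheory.Transcendental.BallRivoal (harm)

variable {p : ℕ} [hp : Fact p.Prime]

/-! ## §1 Small tools -/

/-- `‖2‖_p = 1` for odd `p`. -/
theorem padicNorm_two (hp2 : p ≠ 2) : padicNorm p (2 : ℚ) = 1 := by
  have := (padicNorm.nat_eq_one_iff (p := p) 2).2 (by
    intro h; exact hp2 ((Nat.prime_dvd_prime_iff_eq hp.out Nat.prime_two).1 h))
  exact_mod_cast this

omit hp in
/-- Indicator sums over a subset. -/
theorem sum_ite_mem_subset {s t : Finset ℕ} (h : t ⊆ s) (f : ℕ → ℚ) :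
    ∑ x ∈ s, (if x ∈ t then f x else 0) = ∑ x ∈ t, f x := by
  rw [Finset.sum_ite_mem, Finset.inter_eq_right.2 h]

/-- `‖ŵ₂_x‖ ≤ 1`. -/
theorem padicNorm_wHat2_le_one (b : ℕ → ℤ) (h0 : 0 ≤ b 0) (hn : (b 0).toNat < p ^ 2) (hp2 : p ≠ 2) (x : ℕ) :
    padicNorm p (wHat2 b p x) ≤ 1 := by
  unfold wHat2
  refine padicNorm.sum_le' (fun q hq => ?_) zero_le_one
  have hqN : q ≤ (b 0).toNat := ((mem_classSet_iff b x q).1 (mem_filter.1 hq).1).1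
  refine (padicNorm.nonarchimedean (p := p)).trans (max_le ?_ ?_)
  · split_ifs
    · rw [padicNorm.mul]
      calc _ ≤ (1 : ℚ) * 1 := mul_le_mul (by simpa using padicNorm.of_nat (p := p) (q / p))
            (padicNorm_classRho_le_one b h0 hqN hn hp2 3) (padicNorm.nonneg _) zero_le_one
        _ = 1 := one_mul _
    · rw [padicNorm.zero]; exact zero_le_one
  · split_ifs
    · exact padicNorm_classRho_le_one b h0 hqN hn hp2 4
    · rw [padicNorm.zero]; exact zero_le_one

/-- `‖v̂₂_x‖ ≤ 1`. -/
theorem padicNorm_vHat2_le_one (b : ℕ → ℤ) (h0 : 0 ≤ b 0) (hn : (b 0).toNat < p ^ 2) (hp2 : p ≠ 2) (x : ℕ) :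
    padicNorm p (vHat2 b p x) ≤ 1 := by
  unfold vHat2
  refine padicNorm.sum_le' (fun q hq => padicNorm.sum_le' (fun σ _ => ?_) zero_le_one) zero_le_one
  have hqN : q ≤ (b 0).toNat := ((mem_classSet_iff b x q).1 (mem_filter.1 hq).1).1
  have hlp : q / p < p := Nat.div_lt_of_lt_mul (by nlinarith [hqN, hn])
  have hin : padicNorm p (((q / p : ℕ) : ℚ) * classRho b p q σ
      + (if (σ : ℤ) + 1 ≤ -netExp b q then classRho b p q (σ + 1) else 0)) ≤ 1 := by
    refine (padicNorm.nonarchimedean (p := p)).trans (max_le ?_ ?_)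
    · rw [padicNorm.mul]
      calc _ ≤ (1 : ℚ) * 1 := mul_le_mul (by simpa using padicNorm.of_nat (p := p) (q / p))
            (padicNorm_classRho_le_one b h0 hqN hn hp2 σ) (padicNorm.nonneg _) zero_le_one
        _ = 1 := one_mul _
    · split_ifs
      · exact padicNorm_classRho_le_one b h0 hqN hn hp2 (σ + 1)
      · rw [padicNorm.zero]; exact zero_le_one
  rw [padicNorm.mul, padicNorm.mul, padicNorm_pow_eq, padicNorm.neg, padicNorm.one, one_pow, one_mul]
  calc _ ≤ (1 : ℚ) * 1 := mul_le_mul hin (padicNorm_harm_le_one hlp σ) (padicNorm.nonneg _) zero_le_one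
    _ = 1 := one_mul _

section Agg

variable (b : ℕ → ℤ) (hb : InPolytope b) (hp5 : 5 ≤ p) (hpn : (p : ℤ) ≤ b 0) (hwin : (b 0 + 2 : ℤ) < (p : ℤ) ^ 2)
  {M : ℕ} (hM : 6 ≤ M) (hMe : Even M) {T : List ℤ} (hT : T.reverse = T)
  (H1 : ∀ x ∈ multipoleClasses b p, -(M : ℤ) ≤ classExp b p x)
  (H2 : ∀ y, y < p → classPoleCount b p y = 1 → -(M : ℤ) + 1 ≤ classNu b p y)
  (H3 : ∀ x ∈ multipoleClasses b p, classExp b p x = -(M : ℤ) → ¬ CentreIn b p x ∧ classTypeList b p x = T)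
  (H4 : ∀ y, y < p → 1 ≤ classPoleCount b p y → classNu b p y = -(M : ℤ) + 1 →
    isRaise T (classTypeList b p y) = true ∨ (¬ (2 : ℤ) ∣ b 0 ∧ CentreIn b p y ∧ classTypeList b p y = T))
include hb hp5 hpn hwin hM hMe hT H1 H2 H3 H4

/-- **AGGREGATION (THEOREM A‴ for one parameter vector).**  There are `p`-integral `X`, `Y` and a scalar `α` with
`W/(−p)^{3−M} ≡ −pX`, `V/(−p)^{−M} ≡ −pY (mod p²)` and `X ≡ ατ_W(T)`, `Y ≡ ατ_V(T) (mod p)`. -/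
theorem aggregate : ∃ α X Y : ℚ, padicNorm p X ≤ 1 ∧ padicNorm p Y ≤ 1 ∧
    padicNorm p (coeffW b / (-(p : ℚ)) ^ (-(M : ℤ) + 3) + (p : ℚ) * X) ≤ (p : ℚ) ^ (-(2 : ℤ)) ∧
    padicNorm p (coeffV b / (-(p : ℚ)) ^ (-(M : ℤ)) + (p : ℚ) * Y) ≤ (p : ℚ) ^ (-(2 : ℤ)) ∧
    padicNorm p (X - α * typeTauW (tTop T) (tList T)) ≤ (p : ℚ) ^ (-(1 : ℤ)) ∧
    padicNorm p (Y - α * typeTauV (tTop T) (tList T)) ≤ (p : ℚ) ^ (-(1 : ℤ)) := by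
  have h0 : 0 ≤ b 0 := hb.1.1
  have hp0 : 0 < p := hp.out.pos
  have hp2 : p ≠ 2 := by omega
  have hpQ : (p : ℚ) ≠ 0 := Nat.cast_ne_zero.2 hp.out.ne_zero
  obtain ⟨-, -, -, hn⟩ := thmA_data b hb hwin
  have hpn' : p ≤ (b 0).toNat := by omega
  have h2n : padicNorm p (2 : ℚ) = 1 := padicNorm_two hp2
  have hhalf : padicNorm p ((1 : ℚ) / 2) = 1 := by rw [padicNorm.div, padicNorm.one, h2n, div_one]
  set m : ℤ := -(M : ℤ) with hm
  set tW := typeTauW (tTop T) (tList T) with htW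
  set tV := typeTauV (tTop T) (tList T) with htV
  set D := (range p).filter (fun x => 2 ≤ classPoleCount b p x ∧ classExp b p x = m) with hD
  set S := (range p).filter (fun y => 1 ≤ classPoleCount b p y ∧ classExp b p y = m + 1) with hS
  have hDsub : D ⊆ range p := filter_subset _ _
  have hSsub : S ⊆ range p := filter_subset _ _
  -- integrality of the ingredients
  have hg1 : ∀ x, x < p → padicNorm p (gHat b p x) ≤ 1 := fun x hx =>
    LevelClass.padicNorm_gHat_le_one b hb hp5 hx
      (mem_filter.2 ⟨mem_range.2 (by have := le_b0_of_lt b hpn hx; omega), rfl⟩)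
  have hφ1 : ∀ x, padicNorm p (phiHat b p x) ≤ 1 := fun x => padicNorm_phiHat_le_one b hp2 x
  have hw1 : ∀ z, padicNorm p (wHat b p z) ≤ 1 := fun z => LevelClass.padicNorm_wHat_le_one b h0 hn hp2 z
  have hv1 : ∀ z, padicNorm p (vHat b p z) ≤ 1 := fun z => LevelClass.padicNorm_vHat_le_one b h0 hn hp2
  have hw21 : ∀ z, padicNorm p (wHat2 b p z) ≤ 1 := fun z => padicNorm_wHat2_le_one b h0 hn hp2 z
  have hv21 : ∀ z, padicNorm p (vHat2 b p z) ≤ 1 := fun z => padicNorm_vHat2_le_one b h0 hn hp2 z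
  -- ### deep classes
  have hDmem : ∀ x ∈ D, x < p ∧ 2 ≤ classPoleCount b p x ∧ classExp b p x = m := fun x hx => by
    obtain ⟨hxr, h⟩ := mem_filter.1 hx; exact ⟨mem_range.1 hxr, h⟩
  have hdeep : ∀ x ∈ D, wHat b p x = 0 ∧ wHat2 b p x = tW / 2 ∧
      vHat2 b p x - (topLevel b p x : ℚ) / 2 * vHat b p x = tV / 2 ∧ vHat b p (conjClass b p x) = vHat b p x ∧
      ¬ CentreIn b p x := by
    intro x hx
    obtain ⟨hxp, h2, hE⟩ := hDmem x hx
    obtain ⟨hc, htl⟩ := H3 x (mem_filter.2 ⟨mem_range.2 hxp, h2⟩) hE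
    have hodd : Odd (3 + classExp b p x) := by
      rw [hE, hm]; obtain ⟨r, hr⟩ := hMe; exact ⟨1 - (r : ℤ), by omega⟩
    obtain ⟨hw0, htw, htv, hvc⟩ := deep_data b hb hpn hT hxp hc htl hodd
    unfold tauW at htw; unfold tauV at htv
    rw [hw0, mul_zero, sub_zero] at htw
    refine ⟨hw0, by rw [htW, ← htw]; ring, by rw [htV, ← htv]; ring, hvc, hc⟩
  -- ### the per-class models
  set MW : ℕ → ℚ := fun x =>
    (if x ∈ D then gHat b p x * (wHat b p x - (p : ℚ) * phiHat b p x * wHat2 b p x) else 0)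
      + (if x ∈ S then -((p : ℚ) * gHat b p x * wHat b p x) else 0) with hMW
  set MV : ℕ → ℚ := fun x =>
    (if x ∈ D then gHat b p x * (vHat b p x - (p : ℚ) * phiHat b p x * vHat2 b p x) else 0)
      + (if x ∈ S then -((p : ℚ) * gHat b p x * vHat b p x) else 0) with hMV
  have hclass : ∀ x ∈ range p,
      padicNorm p (classW b p x / (-(p : ℚ)) ^ (m + 3) - MW x) ≤ (p : ℚ) ^ (-(2 : ℤ)) ∧
      padicNorm p (classV b p x / (-(p : ℚ)) ^ m - MV x) ≤ (p : ℚ) ^ (-(2 : ℤ)) := by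
    intro x hxr
    have hxp := mem_range.1 hxr
    by_cases hxD : x ∈ D
    · obtain ⟨-, h2, hE⟩ := hDmem x hxD
      have hxS : x ∉ S := fun h => by have := (mem_filter.1 h).2.2; omega
      have e1 : MW x = gHat b p x * (wHat b p x - (p : ℚ) * phiHat b p x * wHat2 b p x) := by
        simp only [hMW, if_pos hxD, if_neg hxS, add_zero]
      have e2 : MV x = gHat b p x * (vHat b p x - (p : ℚ) * phiHat b p x * vHat2 b p x) := by
        simp only [hMV, if_pos hxD, if_neg hxS, add_zero]
      rw [e1, e2, ← hE]
      exact ⟨deepW_norm b hb hp5 hwin hxp (by omega), deepV_norm b hb hp5 hwin hxp (by omega) (by omega)⟩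
    by_cases hxS : x ∈ S
    · obtain ⟨-, h1, hE⟩ := mem_filter.1 hxS
      have e1 : MW x = -((p : ℚ) * gHat b p x * wHat b p x) := by simp only [hMW, if_neg hxD, if_pos hxS, zero_add]
      have e2 : MV x = -((p : ℚ) * gHat b p x * vHat b p x) := by simp only [hMV, if_neg hxD, if_pos hxS, zero_add]
      rw [e1, e2, sub_neg_eq_add, sub_neg_eq_add]
      exact ⟨subW_norm b hb hp5 hwin hxp h1 hE, subV_norm b hb hp5 hwin hxp h1 hE⟩
    · have e1 : MW x = 0 := by simp only [hMW, if_neg hxD, if_neg hxS, add_zero]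
      have e2 : MV x = 0 := by simp only [hMV, if_neg hxD, if_neg hxS, add_zero]
      rw [e1, e2, sub_zero, sub_zero]
      have hrestE : 2 ≤ classPoleCount b p x → m + 2 ≤ classExp b p x := by
        intro h2
        have hge := H1 x (mem_filter.2 ⟨hxr, h2⟩)
        have hne1 : classExp b p x ≠ m := fun h => hxD (mem_filter.2 ⟨hxr, h2, h⟩)
        have hne2 : classExp b p x ≠ m + 1 := fun h => hxS (mem_filter.2 ⟨hxr, by omega, h⟩)
        omega
      refine ⟨restW_norm b hb hp5 hwin (by omega) hrestE, restV_norm b hb hp5 hwin hxp fun h1 => ?_⟩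
      by_cases h2 : 2 ≤ classPoleCount b p x
      · exact (hrestE h2).trans (CellA.classExp_le_classNu b p x)
      · have hone : classPoleCount b p x = 1 := by omega
        have hnu := H2 x hxp hone
        by_contra hlt
        have hnu1 : classNu b p x = m + 1 := by omega
        by_cases heq : classNu b p x = classExp b p x
        · exact hxS (mem_filter.2 ⟨hxr, h1, by rw [← heq, hnu1]⟩)
        · have := (tame_of_classNu_ne b heq).2; omega
  -- ### the sums of the models
  set AD := ∑ x ∈ D, gHat b p x * phiHat b p x with hAD
  set CS := ∑ y ∈ S, pairCoeff b p M y with hCS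
  set X := (∑ x ∈ D, gHat b p x * phiHat b p x * wHat2 b p x) + ∑ y ∈ S, gHat b p y * wHat b p y with hX
  set Y := (∑ x ∈ D, gHat b p x * phiHat b p x * (vHat2 b p x - (topLevel b p x : ℚ) / 2 * vHat b p x))
    + ∑ y ∈ S, gHat b p y * vHat b p y with hY
  have hSW : ∑ x ∈ range p, MW x = -((p : ℚ) * X) := by
    have e : ∑ x ∈ range p, MW x = (∑ x ∈ D, gHat b p x * (wHat b p x - (p : ℚ) * phiHat b p x * wHat2 b p x))
        + ∑ y ∈ S, -((p : ℚ) * gHat b p y * wHat b p y) := by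
      rw [hMW, sum_add_distrib, sum_ite_mem_subset hDsub, sum_ite_mem_subset hSsub]
    have hD0 : ∑ x ∈ D, gHat b p x * (wHat b p x - (p : ℚ) * phiHat b p x * wHat2 b p x) =
        -((p : ℚ) * ∑ x ∈ D, gHat b p x * phiHat b p x * wHat2 b p x) := by
      rw [Finset.mul_sum, ← sum_neg_distrib]
      exact sum_congr rfl fun x hx => by rw [(hdeep x hx).1]; ring
    have hS0 : ∑ y ∈ S, -((p : ℚ) * gHat b p y * wHat b p y) = -((p : ℚ) * ∑ y ∈ S, gHat b p y * wHat b p y) := by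
      rw [Finset.mul_sum, ← sum_neg_distrib]
      exact sum_congr rfl fun y _ => by ring
    rw [e, hX, hD0, hS0]; ring
  -- the deep `V`-terms need the pair weight: `Σ_D ĝv̂ ≡ (p/2) Σ_D Lφĝv̂ (mod p²)`
  have hDconj : ∀ x ∈ D, conjClass b p x ∈ D := fun x hx =>
    conj_mem_filter b h0 hp0 hpn' (P := fun c E => 2 ≤ c ∧ E = m) hx
  have hSconj : ∀ y ∈ S, conjClass b p y ∈ S := fun y hy =>
    conj_mem_filter b h0 hp0 hpn' (P := fun c E => 1 ≤ c ∧ E = m + 1) hy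
  have hDv : padicNorm p ((∑ x ∈ D, gHat b p x * vHat b p x)
      - (p : ℚ) / 2 * ∑ x ∈ D, (topLevel b p x : ℚ) * phiHat b p x * gHat b p x * vHat b p x) ≤ (p : ℚ) ^ (-(2 : ℤ)) := by
    have h2s := sum_conj_symm b hpn' D (fun x hx => (hDmem x hx).1) hDconj (fun x => gHat b p x * vHat b p x)
    have e : (∑ x ∈ D, gHat b p x * vHat b p x)
        - (p : ℚ) / 2 * ∑ x ∈ D, (topLevel b p x : ℚ) * phiHat b p x * gHat b p x * vHat b p x =
        (1 : ℚ) / 2 * ∑ x ∈ D, ((gHat b p x + gHat b p (conjClass b p x)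
          - (topLevel b p x : ℚ) * p * phiHat b p x * gHat b p x) * vHat b p x) := by
      have : ∑ x ∈ D, (gHat b p x * vHat b p x + gHat b p (conjClass b p x) * vHat b p (conjClass b p x)) =
          ∑ x ∈ D, (gHat b p x + gHat b p (conjClass b p x)) * vHat b p x :=
        sum_congr rfl fun x hx => by rw [(hdeep x hx).2.2.2.1]; ring
      have h3 : ∑ x ∈ D, gHat b p x * vHat b p x =
          (1 : ℚ) / 2 * ∑ x ∈ D, (gHat b p x + gHat b p (conjClass b p x)) * vHat b p x := by
        rw [← this, ← h2s]; ring
      have h4 : (1 : ℚ) / 2 * (∑ x ∈ D, (gHat b p x + gHat b p (conjClass b p x)) * vHat b p x)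
          - (p : ℚ) / 2 * ∑ x ∈ D, (topLevel b p x : ℚ) * phiHat b p x * gHat b p x * vHat b p x =
          (1 : ℚ) / 2 * ∑ x ∈ D, ((gHat b p x + gHat b p (conjClass b p x)
            - (topLevel b p x : ℚ) * p * phiHat b p x * gHat b p x) * vHat b p x) := by
        rw [Finset.mul_sum, Finset.mul_sum, Finset.mul_sum, ← sum_sub_distrib]
        exact sum_congr rfl fun x _ => by ring
      rw [h3, h4]
    rw [e, padicNorm.mul, hhalf, one_mul]
    refine padicNorm.sum_le' (fun x hx => ?_) (zpow_p_nonneg _)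
    obtain ⟨hxp, -, hE⟩ := hDmem x hx
    have hxn := le_b0_of_lt b hpn hxp
    obtain ⟨hL, hL'⟩ := level_bounds' (p := p) b hxn
    have heven : Even (classExp b p x) := by rw [hE, hm]; obtain ⟨r, hr⟩ := hMe; exact ⟨-(r : ℤ), by omega⟩
    have hpair := gHat_pair_second b hb hp5 hxp hL hL' (hdeep x hx).2.2.2.2 heven
    rw [padicNorm.mul]
    calc _ ≤ (p : ℚ) ^ (-(2 : ℤ)) * 1 := mul_le_mul hpair (hv1 _) (padicNorm.nonneg _) (zpow_p_nonneg _)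
      _ = _ := mul_one _
  have hSV : padicNorm p (∑ x ∈ range p, MV x + (p : ℚ) * Y) ≤ (p : ℚ) ^ (-(2 : ℤ)) := by
    have e : ∑ x ∈ range p, MV x + (p : ℚ) * Y = (∑ x ∈ D, gHat b p x * vHat b p x)
        - (p : ℚ) / 2 * ∑ x ∈ D, (topLevel b p x : ℚ) * phiHat b p x * gHat b p x * vHat b p x := by
      have eMV : ∑ x ∈ range p, MV x = (∑ x ∈ D, gHat b p x * (vHat b p x - (p : ℚ) * phiHat b p x * vHat2 b p x))
          + ∑ y ∈ S, -((p : ℚ) * gHat b p y * vHat b p y) := by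
        rw [hMV, sum_add_distrib, sum_ite_mem_subset hDsub, sum_ite_mem_subset hSsub]
      have hD1 : (∑ x ∈ D, gHat b p x * (vHat b p x - (p : ℚ) * phiHat b p x * vHat2 b p x))
          + (p : ℚ) * ∑ x ∈ D, gHat b p x * phiHat b p x * (vHat2 b p x - (topLevel b p x : ℚ) / 2 * vHat b p x) =
          (∑ x ∈ D, gHat b p x * vHat b p x)
            - (p : ℚ) / 2 * ∑ x ∈ D, (topLevel b p x : ℚ) * phiHat b p x * gHat b p x * vHat b p x := by
        rw [Finset.mul_sum, Finset.mul_sum, ← sum_add_distrib, ← sum_sub_distrib]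
        exact sum_congr rfl fun x _ => by ring
      have hS1 : (∑ y ∈ S, -((p : ℚ) * gHat b p y * vHat b p y)) + (p : ℚ) * ∑ y ∈ S, gHat b p y * vHat b p y = 0 := by
        rw [Finset.mul_sum, ← sum_add_distrib]
        exact sum_eq_zero fun y _ => by ring
      rw [eMV, hY, mul_add]
      linear_combination hD1 + hS1
    rw [e]; exact hDv
  -- ### `X ≡ α τ_W`, `Y ≡ α τ_V`
  have hSpair : padicNorm p ((2 * ∑ y ∈ S, gHat b p y * wHat b p y) - CS * tW) ≤ (p : ℚ) ^ (-(1 : ℤ)) ∧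
      padicNorm p ((2 * ∑ y ∈ S, gHat b p y * vHat b p y) - CS * tV) ≤ (p : ℚ) ^ (-(1 : ℤ)) := by
    rw [sum_conj_symm b hpn' S (fun y hy => mem_range.1 (hSsub hy)) hSconj,
      sum_conj_symm b hpn' S (fun y hy => mem_range.1 (hSsub hy)) hSconj, hCS, sum_mul, sum_mul, ← sum_sub_distrib,
      ← sum_sub_distrib]
    constructor
    · refine padicNorm.sum_le' (fun y hy => ?_) (zpow_p_nonneg _)
      obtain ⟨hyr, h1, hE⟩ := mem_filter.1 hy
      exact (sub_pair_norm b hb hp5 hpn hwin hM hMe hT H4 (mem_range.1 hyr) h1 hE).1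
    · refine padicNorm.sum_le' (fun y hy => ?_) (zpow_p_nonneg _)
      obtain ⟨hyr, h1, hE⟩ := mem_filter.1 hy
      exact (sub_pair_norm b hb hp5 hpn hwin hM hMe hT H4 (mem_range.1 hyr) h1 hE).2
  refine ⟨(AD + CS) / 2, X, Y, ?_, ?_, ?_, ?_, ?_, ?_⟩
  · -- `X` is integral
    rw [hX]
    refine (padicNorm.nonarchimedean (p := p)).trans (max_le ?_ ?_)
    · refine padicNorm.sum_le' (fun x hx => ?_) zero_le_one
      rw [padicNorm.mul, padicNorm.mul]
      calc _ ≤ (1 : ℚ) * 1 * 1 := mul_le_mul (mul_le_mul (hg1 x (hDmem x hx).1) (hφ1 x) (padicNorm.nonneg _) zero_le_one)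
            (hw21 x) (padicNorm.nonneg _) (by norm_num)
        _ = 1 := by ring
    · refine padicNorm.sum_le' (fun y hy => ?_) zero_le_one
      rw [padicNorm.mul]
      calc _ ≤ (1 : ℚ) * 1 := mul_le_mul (hg1 y (mem_range.1 (hSsub hy))) (hw1 y) (padicNorm.nonneg _) zero_le_one
        _ = 1 := one_mul _
  · -- `Y` is integral
    rw [hY]
    refine (padicNorm.nonarchimedean (p := p)).trans (max_le ?_ ?_)
    · refine padicNorm.sum_le' (fun x hx => ?_) zero_le_one
      have hin : padicNorm p (vHat2 b p x - (topLevel b p x : ℚ) / 2 * vHat b p x) ≤ 1 := by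
        refine (padicNorm.sub (p := p)).trans (max_le (hv21 x) ?_)
        rw [padicNorm.mul, padicNorm.div, h2n, div_one]
        calc _ ≤ (1 : ℚ) * 1 := mul_le_mul (by simpa using padicNorm.of_nat (p := p) (topLevel b p x)) (hv1 x)
              (padicNorm.nonneg _) zero_le_one
          _ = 1 := one_mul _
      rw [padicNorm.mul, padicNorm.mul]
      calc _ ≤ (1 : ℚ) * 1 * 1 := mul_le_mul (mul_le_mul (hg1 x (hDmem x hx).1) (hφ1 x) (padicNorm.nonneg _) zero_le_one)
            hin (padicNorm.nonneg _) (by norm_num)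
        _ = 1 := by ring
    · refine padicNorm.sum_le' (fun y hy => ?_) zero_le_one
      rw [padicNorm.mul]
      calc _ ≤ (1 : ℚ) * 1 := mul_le_mul (hg1 y (mem_range.1 (hSsub hy))) (hv1 y) (padicNorm.nonneg _) zero_le_one
        _ = 1 := one_mul _
  · -- `W/(−p)^{m+3} + pX = Σ_x (W_x/(−p)^{m+3} − MW x)`
    have e : coeffW b / (-(p : ℚ)) ^ (-(M : ℤ) + 3) + (p : ℚ) * X =
        ∑ x ∈ range p, (classW b p x / (-(p : ℚ)) ^ (m + 3) - MW x) := by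
      rw [sum_sub_distrib, hSW, coeffW_eq_sum_classW b hp0, sum_div]; ring
    rw [e]
    exact padicNorm.sum_le' (fun x hx => (hclass x hx).1) (zpow_p_nonneg _)
  · have e : coeffV b / (-(p : ℚ)) ^ (-(M : ℤ)) + (p : ℚ) * Y =
        (∑ x ∈ range p, (classV b p x / (-(p : ℚ)) ^ m - MV x)) + (∑ x ∈ range p, MV x + (p : ℚ) * Y) := by
      rw [sum_sub_distrib, coeffV_eq_sum_classV b hp0, sum_div]; ring
    rw [e]
    exact (padicNorm.nonarchimedean (p := p)).trans
      (max_le (padicNorm.sum_le' (fun x hx => (hclass x hx).2) (zpow_p_nonneg _)) hSV)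
  · -- `X − α τ_W = ½ (2Σ_S ĝŵ − CS τ_W)` since `ŵ₂ = τ_W/2` on deep classes
    have e : X - (AD + CS) / 2 * tW = (1 : ℚ) / 2 * ((2 * ∑ y ∈ S, gHat b p y * wHat b p y) - CS * tW) := by
      have hDsum : ∑ x ∈ D, gHat b p x * phiHat b p x * wHat2 b p x = AD * tW / 2 := by
        rw [hAD, sum_mul, sum_div]
        exact sum_congr rfl fun x hx => by rw [(hdeep x hx).2.1]; ring
      rw [hX, hDsum]; ring
    rw [e, padicNorm.mul, hhalf, one_mul]
    exact hSpair.1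
  · have e : Y - (AD + CS) / 2 * tV = (1 : ℚ) / 2 * ((2 * ∑ y ∈ S, gHat b p y * vHat b p y) - CS * tV) := by
      have hDsum : ∑ x ∈ D, gHat b p x * phiHat b p x * (vHat2 b p x - (topLevel b p x : ℚ) / 2 * vHat b p x) =
          AD * tV / 2 := by
        rw [hAD, sum_mul, sum_div]
        exact sum_congr rfl fun x hx => by rw [(hdeep x hx).2.2.1]; ring
      rw [hY, hDsum]; ring
    rw [e, padicNorm.mul, hhalf, one_mul]
    exact hSpair.2

end Agg

end Summit.KontsevichZagierPeriods.Zeta5Search.SecondOrder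

end
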